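import Summits.KontsevichZagierPeriods.KontsevichZagierPeriods.Theses.SphericalSchlafli
import Summits.KontsevichZagierPeriods.KontsevichZagierPeriods.Theorems.FurushoPentagonSectorToKernelAyoubKernelOnResolved

/-!
# `VolumeFormOfCubes` (stmt-KontsevichZagierPeriods-18450, route SphericalSchlafli) — proof

The SPLIT GLUE `CubeResolution → AyoubEffectiveCubeKernel → VolumeForm` of the frame item `VolumeForm`
(stmt-3814: two integrand-`1` representations of one dimension with equal volume are KZ-equivalent) along
Ayoub's normal-form seam (crux-strategist r1 of crux 3814, BC2 redirect; published sorry-free as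
`Cruxes/VolumeForm/SplitGlue.lean`, `VolumeForm_of_cubes`), re-homed under `Theorems/` by lead c10 of crux
stmt-9129 (line Sketch, banking). The two pieces:

* **X₁ = `CubeResolution`** (stmt-17978, geometry inside the rules): every integral representation is
  congruent modulo `KZ.relations` to a `ℤ`-combination of TAME CUBE classes `[[0,1]ⁿ, f]`, `f` real analytic
  on a neighbourhood of the closed cube;
* **X₂ = `AyoubEffectiveCubeKernel`** (stmt-18116, Ayoub, Ann. of Math. 181 (2015) Conj. 1.1 at `k = ℚ`):
  the kernel of `∫_{[0,1]^∞}` on `𝒪_{ℚ-alg}(𝔻̄^∞)` is the `ℚ`-span of the Stokes elements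
  `∂G/∂zᵢ − G|_{zᵢ=1} + G|_{zᵢ=0}`.

ASSEMBLY (every step a landed theorem of line `effective-cube-surjection`,
`Theorems/FurushoPentagonSectorToKernelAyoubKernelOnResolved.lean`): given bodies `r`, `r'` with
`vol r = vol r'`, put `c = [r] − [r']`, `eval c = 0`; (1) RESOLVE both bodies (X₁): `c ≡ a − a'` in the tame
cubical span; (2) MERGE to one tame cube class `[t]` (`ReducedPeriodRing.stub_cubeMerge`); (3) Ayoub-ADMISSIBLE
expansion `[t] ≡ [s]` (`stub_admissibleOfTame`); (4) SOUNDNESS `∫_{[0,1]ⁿ} s = eval c = 0`; (5) X₂ ⟹ the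
padded integrand is a REAL STOKES COMBINATION with analytic algebraic, hence `ℚ`-semialgebraic, primitives
(`stub_realStokesForm`, `stub_semialgebraicOfAlgebraic`); (6) PAD by dummy variables and CALIBRATE each
Stokes element as one Newton–Leibniz move (`stub_stokesSpanCalibration`); (7) hence `c ∈ KZ.relations`.
Strength record (honest): in the tree X₂ and the frame are incomparable; `X₂ → VolumeForm` is known only
through X₁ (this file) — see `Cruxes/VolumeForm/SplitGlue.lean` and `Cruxes/ReductionRigidity/SplitR1Glue.lean`.

References: M. Kontsevich, D. Zagier, *Periods* (2001), §1.1–1.2; J. Ayoub, Ann. of Math. 181 (2015),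
Conj. 1.1, Rem. 1.2, Fait 1.4; J. Ayoub, EMS Newsl. 91 (2014), Def. 9–10, Prop. 11, Rem. 12–13;
A. Huber, S. Müller-Stach, *Periods and Nori Motives* (2017), §12.2; J. Viu-Sos, IJNT 17 (2021), Thm. 1.1.
-/

noncomputable section

namespace Summit.KontsevichZagierPeriods.SphericalSchlafli.VolumeFormOfCubes

open Set MeasureTheory
open Literature.NumberTheory.Transcendental
open Literature.NumberTheory.Transcendental.KZ hiding cubicalSpan
open Summit.KontsevichZagierPeriods.FurushoPentagon.ReducedPeriodRing (unitCube cubicalGens cubicalSpan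
  stub_cubeMerge)
open Summit.KontsevichZagierPeriods.FurushoPentagon.SectorToKernel

/-- **X₁ ⟹ resolution in the tree's vocabulary**: the import-free child `CubeResolution` (stmt-17978) is,
up to unfolding `ReducedPeriodRing.unitCube` / `cubicalGens` / `cubicalSpan`, the registered stub S1 of
crux stmt-10813. [Ayoub 2014, Rem. 12] [folklore] -/
theorem resolved_of_cubeResolution
    (h1 : Summit.KontsevichZagierPeriods.KontsevichZagierPeriods.Theses.SphericalSchlafli.CubeResolution)
    (N : ℕ) (u : IntegralRep N) : ∃ a : FormalRep, a ∈ cubicalSpan ∧ of u - a ∈ relations := by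
  obtain ⟨c, hc, e⟩ := h1 N u
  exact ⟨c, hc, e⟩

/-- **The glue item `VolumeFormOfCubes`** (route SphericalSchlafli, stmt-KontsevichZagierPeriods-18450):
`CubeResolution → AyoubEffectiveCubeKernel → VolumeForm` — if every integral representation resolves by
moves to a `ℤ`-combination of tame cube classes (X₁) and Ayoub's effective cube conjecture holds at `k = ℚ`
(X₂), then two integrand-`1` representations of one dimension with equal value are KZ-equivalent. Proof:
the construction (1)–(7) of the module docstring (resolve, merge, admissible expansion, soundness, real
Stokes form from X₂, pad and calibrate), every step a landed theorem of the tree; the planner's published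
split-glue proof `VolumeForm_of_cubes` re-homed.
[Ayoub 2015, Conj. 1.1; Ayoub 2014, Rem. 12–13; Kontsevich–Zagier 2001, §1.2] [folklore] -/
theorem volumeFormOfCubes_proof :
    Summit.KontsevichZagierPeriods.KontsevichZagierPeriods.Theses.SphericalSchlafli.VolumeFormOfCubes := by
  intro h1 h6 N r r' _h1 _h1' hv
  -- the class to be shown a relation, and its value
  set c : FormalRep := of r - of r' with hc_def
  have hc0 : eval c = 0 := by
    rw [hc_def, map_sub, eval_of, eval_of, hv, sub_self]
  -- (1) RESOLUTION inside the rules (piece X₁): `c ≡ a − a'`, a `ℤ`-combination of tame cube classes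
  obtain ⟨a, ha, hra⟩ := resolved_of_cubeResolution h1 N r
  obtain ⟨a', ha', hra'⟩ := resolved_of_cubeResolution h1 N r'
  have hca : c - (a - a') ∈ relations := by
    have e : c - (a - a') = (of r - a) - (of r' - a') := by rw [hc_def]; abel
    rw [e]
    exact relations.sub_mem hra hra'
  -- (2) MERGE into one tame cube class `[t]`
  obtain ⟨n, t, htd, hta, hat⟩ := stub_cubeMerge (a - a') (cubicalSpan.sub_mem ha ha')
  rw [leaves_unitCube_eq_cube] at htd hta
  -- (3) Ayoub-ADMISSIBLE expansion `[t] ≡ [s]`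
  obtain ⟨s, hsd, hadm, hts⟩ := stub_admissibleOfTame n t htd hta
  have hcs : c - of s ∈ relations := by
    have e : c - of s = (c - (a - a')) + ((a - a') - of t) + (of t - of s) := by abel
    rw [e]
    exact relations.add_mem (relations.add_mem hca hat) hts
  -- (4) SOUNDNESS: `∫_{[0,1]ⁿ} s = eval c = 0`
  have hs0 : ∫ x in KZ.cube n, s.integrand x = 0 := by
    have h0 : eval (c - of s) = 0 := relations_le_ker_eval_holds hcs
    rw [map_sub, hc0, zero_sub, neg_eq_zero, leaves_eval_of_eq_setIntegral_cube s hsd] at h0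
    exact h0
  -- (5) piece X₂: REAL STOKES FORM of the padded integrand, with analytic algebraic (hence
  --     `ℚ`-semialgebraic) primitives
  obtain ⟨d, k, i, H, hH, hid⟩ := stub_realStokesForm h6 n s hsd hadm hs0
  have hHs : ∀ j, AnalyticOnNhd ℝ (H j) (KZ.cube (n + d)) ∧
      IsSemialgebraicFunOn ℚ (KZ.cube (n + d)) (H j) :=
    fun j => ⟨(hH j).1, stub_semialgebraicOfAlgebraic (n + d) (H j) (hH j).1 (hH j).2⟩
  -- (6) PAD `s` by `d` dummy variables and CALIBRATE the Stokes combination inside the rules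
  obtain ⟨u, hud, hui⟩ := leaves_exists_oneCube d
  have hpd : (s.prod u).domain = KZ.cube (n + d) := by
    rw [IntegralRep.prod_domain, leaves_prodDomain_eq_cube s u hsd hud]
  have hpi : ∀ z ∈ KZ.cube (n + d), (s.prod u).integrand z =
      ∑ j, (fderiv ℝ (H j) z (Pi.single (i j) 1) - H j (Function.update z (i j) 1) +
        H j (Function.update z (i j) 0)) := by
    intro z hz
    rw [leaves_prod_oneCube_integrand s u hui z]
    exact hid z hz
  have hpad : of (s.prod u) ∈ relations :=
    stub_stokesSpanCalibration (n + d) (s.prod u) hpd k i H hHs hpi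
  have hsu : of s - of (s.prod u) ∈ relations := leaves_of_sub_of_prod_oneCube s u hud hui
  -- (7) conclude: `[r] − [r'] ∈ KZ.relations`
  have e : c = (c - of s) + (of s - of (s.prod u)) + of (s.prod u) := by abel
  show of r - of r' ∈ relations
  rw [← hc_def, e]
  exact relations.add_mem (relations.add_mem hcs hsu) hpad

end Summit.KontsevichZagierPeriods.SphericalSchlafli.VolumeFormOfCubes

end
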